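import Summits.NavierStokesRegularity.FunctionalMining.MiddleEigenvalueMomentDoor
import Summits.NavierStokesRegularity.FunctionalMining.MiddleEigenvalueMomentDoorReal
import Summits.NavierStokesRegularity.FunctionalMining.NoGo.ConjectureF
import Summits.NavierStokesRegularity.FunctionalMining.NoGo.MiddleEigenvalueKit
import HarnessLib

/-!
# Conjecture S⁻ — feasible fields are stretching-negative — and its kill-all witness (FunctionalMining no-go, gen 6)

Search for candidate a priori estimates; no regularity claim. Staged by the no-go seat (gen 6) for
the PROVE seat; target tree path `Summits/NavierStokesRegularity/FunctionalMining/NoGo/ConjectureS.lean`.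

The K1-Q2 rows `MiddleEigenvalueMomentRateBound (2m) C` (`q = 2m ≥ 4`) can be refuted FOR EVERY
CONSTANT `C` AT ONCE by one static field (`middleEigenvalueMomentRateFails_of_nonpos_middle`): a
smooth divergence-free `v` on `T³` with middle strain eigenvalue `λ₂(S(x)) ≤ 0` everywhere
("feasible") and positive weighted stretching `2m∫|ω|^{2(m−1)}σ > 0`. The no-go seat's search for such
a field (NOGO.md N11(h), gens 4–6) found: (i) feasible fields with `λ₂ < 0` everywhere plausibly exist
(CONJECTURE_F.md, THEOREM F̄, first-order LP evidence) but none is explicit yet; (ii) on every class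
where the sign of the moments can be decided it is `≤ 0` under feasibility — `m = 1` (Betchov–Miller,
all fields), the vertical/2.5D class (all `m`, `weightedStretching_nonpos_of_vertical`), pattern bases
(`= 0`), first order at every unidirectional shear (exact identity `δM_q[B] = ⟨|ω_A|^q G_B⟩`, NOGO
(F9)(vii)(a)), first order at the generic pattern base `b` (LP, (F9)(vii)(c)), and the exact moments of
every near-feasible design of the direct search (`M₄, M₆ < 0`, (F9)(iii)). This file records the
resulting conjecture as a NAMED PROP (nothing asserted) together with its proved skeleton — AND (v3, §5)
the explicit KILL-ALL WITNESS found at the end of gen 6, which REFUTES S⁻(2) on paper (the degenerate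
class `det S ≡ 0`, never needed to be strict, contains witnesses; kernel instance pending):

* `FeasibleStretchingNonpos hd m` — CONJECTURE S⁻(m) [ours; `m = 1` theorem; `m = 2` REFUTED ON PAPER by the
  explicit kill-all witness of §5 (v3, 2026-08-20T06:45Z; kernel instance pending); `m = 3, 4` refuted numerically];
* `feasibleStretchingNonpos_of_static` / `_of_rateBound` — any surviving constant `C` for the row
  `q = 2m` forces S⁻(m) (the `Λ = 0` slice of the static door) [ours; elementary];
* `feasibleStretchingNonpos_one` — S⁻(1) is a THEOREM (tree `middleEigenvalueStretchingStatic_one`,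
  Betchov–Miller) [folklore; ours as a corollary];
* `not_feasibleStretchingNonpos_iff` — the DICHOTOMY: `¬S⁻(m)` is literally the existence of a
  kill-all witness, and then every constant dies (`killAll_of_not_feasibleStretchingNonpos`);
  `S⁻(m)` says the kill-all door's hypotheses are jointly unsatisfiable
  (`not_killAll_hypotheses_of_feasibleStretchingNonpos`) — the T17 witness class of NOGO.md is empty;
* `feasibleStretchingNonpos_vertical` — the 2.5D instance, all `m` (dictionary theorem, restated);
* `FeasibleStretchingNonpos.moment_nonpos_of_det_pos` — how a THEOREM-F̄ witness (`det S > 0`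
  everywhere) would DECIDE S⁻(m): by the sign of one integral.

References: NOGO.md v7.7 N11(h)(F9)(vii); CONJECTURE_F.md v2.2 §9; Miller, Arch. Ration. Mech. Anal.
2023 (Prop. 1.9, Thm 1.12) [lit p195623]; Betchov, J. Fluid Mech. 1 (1956). Search for candidate a
priori estimates; no regularity claim.
-/

noncomputable section

open MeasureTheory

namespace Summit.NavierStokesRegularity.FunctionalMining

open Literature.Analysis Literature.Analysis.FunctionSpaces Literature.Analysis.FunctionSpaces.Torus
  Literature.Analysis.FluidPDE

variable {d : Type*} [Fintype d] [DecidableEq d]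

/-- **CONJECTURE S⁻(m) (feasible fields are stretching-negative).** For every smooth divergence-free
`v` on `T³` whose middle strain eigenvalue is `≤ 0` at every point (Mathlib's decreasing
`eigenvalues₀`, index `1` of `3`, of `Sᵢⱼ = ½((∂ⱼv)ᵢ + (∂ᵢv)ⱼ)` — exactly the hypothesis of
`middleEigenvalueMomentRateFails_of_nonpos_middle`), the weighted stretching
`2m ∫ |ω|^{2(m−1)} σ` is `≤ 0` (`σ = torusStretchingDensity v = ωᵀSω` for divergence-free `v`).
TRUE at `m = 1` (`feasibleStretchingNonpos_one`); FALSE at `m = 2` — explicit kill-all witness, §5 and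
KILLALL-WITNESS.md (paper proof; the kernel refutation `not_feasibleStretchingNonpos_two` is the PROVE
seat's target; §5 holds its kernel-checked pointwise core); numerically false at `m = 3, 4`. Nothing is
asserted. Search for candidate a priori estimates; no regularity claim.
[ours; conjecture] -/
@[conjecture] def FeasibleStretchingNonpos (hd : Fintype.card d = 3) (m : ℕ) : Prop :=
  ∀ v : UnitAddTorus d → EuclideanSpace ℝ d, Torus.IsSmooth v → Torus.IsDivFree v →
    (∀ x, ∀ hx : (Matrix.of fun i j =>
        (Torus.partialDeriv j v x i + Torus.partialDeriv i v x j) / 2).IsHermitian,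
        hx.eigenvalues₀ (Fin.cast hd.symm 1) ≤ 0) →
      2 * m * ∫ x, torusVorticitySqAt v x ^ (m - 1) * torusStretchingDensity v x ≤ 0

/-! ## 1. Any surviving constant forces S⁻ -/

/-- The `Λ = 0` slice of the static K1-Q2 inequality is S⁻(m): if
`MiddleEigenvalueStretchingStatic m C` holds for SOME constant `C`, then S⁻(m). [ours; elementary] -/
theorem feasibleStretchingNonpos_of_static {m : ℕ} {C : ℝ} (hd : Fintype.card d = 3)
    (h : MiddleEigenvalueStretchingStatic (d := d) m C) : FeasibleStretchingNonpos (d := d) hd m := by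
  intro v hv hdiv hΛ
  simpa using h hd v hv hdiv 0 le_rfl hΛ

/-- If the dynamic row `MiddleEigenvalueMomentRateBound (2m) C` holds for SOME `C`, then S⁻(m)
(dynamic ⇒ static, `MiddleEigenvalueMomentRateBound.static_evenMoment`, then `Λ = 0`).
Contrapositive of the kill-all door. [ours; elementary] -/
theorem feasibleStretchingNonpos_of_rateBound {m : ℕ} {C : ℝ} (hd : Fintype.card d = 3)
    (h : MiddleEigenvalueMomentRateBound (d := d) (2 * m) C) :
    FeasibleStretchingNonpos (d := d) hd m :=
  feasibleStretchingNonpos_of_static hd h.static_evenMoment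

/-- **S⁻(1) is a theorem**: `2∫σ ≤ 0` whenever `λ₂ ≤ 0` everywhere (Betchov `∫σ = −4∫det S` and
`det S = λ₁λ₂λ₃ ≥ 0`; here via the tree's calibrated `q = 2` row, Miller L5.1).
[folklore; ours as a corollary] -/
theorem feasibleStretchingNonpos_one (hd : Fintype.card d = 3) :
    FeasibleStretchingNonpos (d := d) hd 1 :=
  feasibleStretchingNonpos_of_static hd middleEigenvalueStretchingStatic_one

/-! ## 2. The dichotomy -/

/-- **`¬S⁻(m)` is literally the existence of a kill-all witness.** [ours; bookkeeping] -/
theorem not_feasibleStretchingNonpos_iff {m : ℕ} (hd : Fintype.card d = 3) :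
    ¬ FeasibleStretchingNonpos (d := d) hd m ↔
      ∃ v : UnitAddTorus d → EuclideanSpace ℝ d, Torus.IsSmooth v ∧ Torus.IsDivFree v ∧
        (∀ x, ∀ hx : (Matrix.of fun i j =>
            (Torus.partialDeriv j v x i + Torus.partialDeriv i v x j) / 2).IsHermitian,
            hx.eigenvalues₀ (Fin.cast hd.symm 1) ≤ 0) ∧
        0 < 2 * m * ∫ x, torusVorticitySqAt v x ^ (m - 1) * torusStretchingDensity v x := by
  simp only [FeasibleStretchingNonpos, not_forall, not_le, exists_prop]

/-- `¬S⁻(m)` kills the row `q = 2m` for EVERY constant (the door, through the dichotomy).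
[ours; elementary] -/
theorem killAll_of_not_feasibleStretchingNonpos {m : ℕ} (hd : Fintype.card d = 3)
    (h : ¬ FeasibleStretchingNonpos (d := d) hd m) :
    ∀ C : ℝ, ¬ MiddleEigenvalueMomentRateBound (d := d) (2 * m) C :=
  fun _ hC => h (feasibleStretchingNonpos_of_rateBound hd hC)

/-- Conversely, under S⁻(m) the two hypotheses of `middleEigenvalueMomentRateFails_of_nonpos_middle`
are jointly unsatisfiable: NO static feasible field refutes the row `q = 2m` for all constants (the
T17 witness class of NOGO.md is empty). [ours; elementary] -/
theorem not_killAll_hypotheses_of_feasibleStretchingNonpos {m : ℕ} (hd : Fintype.card d = 3)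
    (h : FeasibleStretchingNonpos (d := d) hd m) {v : UnitAddTorus d → EuclideanSpace ℝ d}
    (hv : Torus.IsSmooth v) (hdiv : Torus.IsDivFree v)
    (hΛ : ∀ x, ∀ hx : (Matrix.of fun i j =>
        (Torus.partialDeriv j v x i + Torus.partialDeriv i v x j) / 2).IsHermitian,
        hx.eigenvalues₀ (Fin.cast hd.symm 1) ≤ 0) :
    ¬ (0 < 2 * m * ∫ x, torusVorticitySqAt v x ^ (m - 1) * torusStretchingDensity v x) :=
  not_lt.mpr (h v hv hdiv hΛ)

/-! ## 3. Decided sub-classes -/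

/-- **S⁻ on the vertical (2.5D) class, every `m`** — the dictionary's theorem
`weightedStretching_nonpos_of_vertical`, restated in the shape of the conjecture. [ours; elementary] -/
theorem feasibleStretchingNonpos_vertical (m : ℕ) (hd : Fintype.card (Fin 3) = 3)
    {v : UnitAddTorus (Fin 3) → EuclideanSpace ℝ (Fin 3)} (hv : Torus.IsSmooth v)
    (hdiv : Torus.IsDivFree v) (h2 : ∀ x k, Torus.partialDeriv 2 v x k = 0)
    (hΛ : ∀ x, ∀ hx : (Matrix.of fun i j : Fin 3 =>
        (Torus.partialDeriv j v x i + Torus.partialDeriv i v x j) / 2).IsHermitian,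
        hx.eigenvalues₀ (Fin.cast hd.symm 1) ≤ 0) :
    2 * m * ∫ x, torusVorticitySqAt v x ^ (m - 1) * torusStretchingDensity v x ≤ 0 :=
  weightedStretching_nonpos_of_vertical m hd (hv.isContDiff (by simp)) hdiv h2 hΛ

/-- **How a THEOREM-F̄ witness decides S⁻(m).** A smooth divergence-free `v` with `det S > 0` at
every point is feasible (`det S ≥ 0 ⇔ λ₂ ≤ 0` for trace-free symmetric `3 × 3`,
`det_nonneg_iff_middleEigenvalue_nonpos`), so under S⁻(m) its weighted stretching is `≤ 0`; a
det-positive field with ONE positive weighted moment refutes S⁻(m) and, through the door, the whole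
row `q = 2m`. [ours; elementary] -/
theorem FeasibleStretchingNonpos.moment_nonpos_of_det_pos {m : ℕ} (hd : Fintype.card d = 3)
    (h : FeasibleStretchingNonpos (d := d) hd m) {v : UnitAddTorus d → EuclideanSpace ℝ d}
    (hv : Torus.IsSmooth v) (hdiv : Torus.IsDivFree v)
    (hdet : ∀ x, 0 < (Matrix.of fun i j =>
        (Torus.partialDeriv j v x i + Torus.partialDeriv i v x j) / 2).det) :
    2 * m * ∫ x, torusVorticitySqAt v x ^ (m - 1) * torusStretchingDensity v x ≤ 0 := by
  refine h v hv hdiv fun x hx => ?_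
  have hsym : (Matrix.of fun i j =>
      (Torus.partialDeriv j v x i + Torus.partialDeriv i v x j) / 2).IsSymm := strainMatrix_isSymm v x
  have htr : (Matrix.of fun i j =>
      (Torus.partialDeriv j v x i + Torus.partialDeriv i v x j) / 2).trace = 0 :=
    strainMatrix_trace_eq_zero (hv.isContDiff (by simp)) hdiv x
  exact (det_nonneg_iff_middleEigenvalue_nonpos hd _ hsym htr).mp (hdet x).le

/-! ## 4. Algebraic core of the sign rules at shears (NOGO (F9)(vii)(a), (vii′))

At a unidirectional shear the vorticity spans the kernel of the strain, so the first variation of the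
stretching `ωᵀSω` in any direction is `ω_Aᵀ δS ω_A` alone; integrated with the weight `|ω_A|^{q-2}`
this is the first-order sign rule `δM_q = ⟨|ω_A|^q · nᵀS_Bn⟩` (same sign structure as `δλ₂ = nᵀS_Bn`).
The analytic statements (perturbation of the middle eigenvalue, the `O(ε³)` identity of (vii′)) are
recorded in NOGO.md only. -/

namespace MiddleEigen

open Matrix

/-- At a unidirectional shear the vorticity lies in the KERNEL of the strain (`S_A ω_A = 0`),
stronger than `ωᵀSω = 0` of `shear_structural_zero`. [folklore] -/
theorem shearStrain_mulVec_shearVorticity (b₁ b₂ : ℝ) :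
    (shearStrain b₁ b₂).mulVec (shearVorticity b₁ b₂) = 0 := by
  ext i
  fin_cases i
  · simp [shearStrain, shearVorticity, Matrix.mulVec, dotProduct, Fin.sum_univ_three]
  · simp [shearStrain, shearVorticity, Matrix.mulVec, dotProduct, Fin.sum_univ_three]
  · simp [shearStrain, shearVorticity, Matrix.mulVec, dotProduct, Fin.sum_univ_three]; ring

/-- **Algebraic core of the first-order sign rule (NOGO (F9)(vii)(a)).** Perturb the shear strain and
vorticity, `S = S_A + εT`, `ω = ω_A + εw` (`T` symmetric): because `S_A ω_A = 0` the stretching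
`ωᵀSω` has NO `ε⁰` term and its `ε¹` coefficient is `ω_Aᵀ T ω_A` alone — the `δω`-terms drop out.
[ours; elementary] -/
theorem shear_stretching_expansion (b₁ b₂ ε : ℝ) (T : Matrix (Fin 3) (Fin 3) ℝ) (hT : T.IsSymm)
    (w : Fin 3 → ℝ) :
    dotProduct (shearVorticity b₁ b₂ + ε • w)
        ((shearStrain b₁ b₂ + ε • T).mulVec (shearVorticity b₁ b₂ + ε • w)) =
      ε * dotProduct (shearVorticity b₁ b₂) (T.mulVec (shearVorticity b₁ b₂)) +
      ε ^ 2 * (dotProduct w ((shearStrain b₁ b₂).mulVec w) +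
        2 * dotProduct w (T.mulVec (shearVorticity b₁ b₂))) +
      ε ^ 3 * dotProduct w (T.mulVec w) := by
  have h10 : T 1 0 = T 0 1 := hT.apply 0 1
  have h20 : T 2 0 = T 0 2 := hT.apply 0 2
  have h21 : T 2 1 = T 1 2 := hT.apply 1 2
  simp [shearStrain, shearVorticity, Matrix.mulVec, dotProduct, Fin.sum_univ_three, Matrix.add_apply,
    Matrix.smul_apply, h10, h20, h21]
  ring

/-! ## 5. The kill-all witness — CONJECTURE S⁻(2) is FALSE (pointwise core, kernel-checked)

THE FIELD ("z-modulated solid-body swirl + coaxial jet", KILLALL-WITNESS.md, NOGO.md v7.8 (F10)): on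
`(ℝ/2πℤ)³`, `v(x,y,z) = χ(r)·V(z)·(−y, x, 0) + U(r)·e_z`, `r² = x² + y²`, `V` smooth periodic, `U, χ`
smooth radial bumps (functions of `r²`) supported in `r < π`, `χ ≡ 1` on a disc containing `supp U`.
It is smooth and divergence-free; its strain has `det S ≡ 0`, hence `λ₂(S) ≡ 0` (feasible,
non-strictly); `σ = ωᵀSω = −4 r V V′ U′` where `χ ≡ 1` and `σ ≡ 0` elsewhere; `∫σ = 0` (Betchov) and
`∫|ω|²σ = 32π · I(V) · ∫₀^∞ r³U dr`, `I(V) := ∫₀^{2π} V V′³ dz`. For `V = cos z + cos 2z − sin 3z`,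
`I(V) = 5π` (exact), so every `U ≥ 0`, `U ≢ 0` gives `∫|ω|²σ = 160π² ∫r³U > 0`: by
`middleEigenvalueMomentRateFails_of_nonpos_middle` (`m = 2`), `∀ C, ¬ MiddleEigenvalueMomentRateBound 4 C`,
i.e. `¬ FeasibleStretchingNonpos hd 2` (and the same field has `∫|ω|⁴σ, ∫|ω|⁶σ > 0` numerically:
`q = 6, 8` die too). MECHANISM: the solid-body rotation carries the vorticity `2V e_z` WITHOUT strain;
the stretching is the tilting of the horizontal vorticity `(−rV′, −U′)` by the two shears `S_ρz = ½U′`,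
`S_θz = ½rV′`, weighted by `ω_z = 2V`, while the strain keeps the degenerate two-pair form
`!![0,0,a; 0,0,b; a,b,0]` of a curvilinear unidirectional shear (`det ≡ 0`) whose null vector is NOT
the vorticity — unlike every Cartesian pattern base, where strain and vorticity both have pattern form
and `σ ≡ 0` (`NoGo/PatternBase`).

Kernel-checked HERE: the pointwise algebra in both regions (strain = symmetrised gradient, vorticity =
axial vector of the gradient, symmetric, trace-free, `det = 0 ⇒ λ₂ = 0`, and the stretching values
`4p(a₁b₂ − a₂b₁)` resp. `0`). NOT YET kernel-checked (PROVE-seat target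
`theorem not_feasibleStretchingNonpos_two (hd : Fintype.card (Fin 3) = 3) : ¬ FeasibleStretchingNonpos hd 2`):
smoothness and `IsDivFree` of the unit-torus version of `v`, the identification of
`Torus.partialDeriv` with these gradients, Fubini in cylindrical variables, and `I(V) = 5π`.
STATUS of S⁻: `m = 1` THEOREM; `m = 2` REFUTED on paper (exact); `m = 3, 4` refuted numerically
(`M₆ = +1532.6`, `M₈ = +46497` for the exact instance with `U = (1−r²)³₊`); generic `m ≥ 2` expected
false (`M_{2m}` is odd in `U`). Search for candidate a priori estimates; no regularity claim. -/

/-- Velocity gradient `G_{ij} = ∂_j v_i` of the kill-all witness in REGION A (`χ ≡ 1`):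
`v = (−V(z)y, V(z)x, U(r))` has `∇v = !![0, −p, a₁; p, 0, a₂; b₁, b₂, 0]` with `p = V(z)`,
`(a₁,a₂) = V′(z)(−y, x)`, `(b₁,b₂) = (U′(r)/r)(x, y)`. [ours] -/
def killAllGradA (p a₁ a₂ b₁ b₂ : ℝ) : Matrix (Fin 3) (Fin 3) ℝ := !![0, -p, a₁; p, 0, a₂; b₁, b₂, 0]

/-- Its strain `S = ½(G + Gᵀ) = !![0,0,s₁; 0,0,s₂; s₁,s₂,0]`, `sᵢ = ½(aᵢ + bᵢ)`. [ours] -/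
def killAllStrainA (a₁ a₂ b₁ b₂ : ℝ) : Matrix (Fin 3) (Fin 3) ℝ :=
  !![0, 0, (a₁ + b₁) / 2; 0, 0, (a₂ + b₂) / 2; (a₁ + b₁) / 2, (a₂ + b₂) / 2, 0]

/-- Its vorticity `ωᵢ = ε_{ijk} G_{kj}`: `ω = (b₂ − a₂, a₁ − b₁, 2p)`. [ours] -/
def killAllVorticityA (p a₁ a₂ b₁ b₂ : ℝ) : Fin 3 → ℝ := ![b₂ - a₂, a₁ - b₁, 2 * p]

/-- The strain of region A is the symmetric part of the gradient. [ours; bookkeeping] -/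
theorem killAllStrainA_apply (p a₁ a₂ b₁ b₂ : ℝ) (i j : Fin 3) :
    killAllStrainA a₁ a₂ b₁ b₂ i j =
      (killAllGradA p a₁ a₂ b₁ b₂ i j + killAllGradA p a₁ a₂ b₁ b₂ j i) / 2 := by
  fin_cases i <;> fin_cases j <;> simp [killAllStrainA, killAllGradA]
  all_goals ring

/-- The vorticity of region A is the axial vector `ωᵢ = ε_{ijk} G_{kj}` of the gradient. [ours; bookkeeping] -/
theorem killAllVorticityA_eq (p a₁ a₂ b₁ b₂ : ℝ) :
    killAllVorticityA p a₁ a₂ b₁ b₂ =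
      ![killAllGradA p a₁ a₂ b₁ b₂ 2 1 - killAllGradA p a₁ a₂ b₁ b₂ 1 2,
        killAllGradA p a₁ a₂ b₁ b₂ 0 2 - killAllGradA p a₁ a₂ b₁ b₂ 2 0,
        killAllGradA p a₁ a₂ b₁ b₂ 1 0 - killAllGradA p a₁ a₂ b₁ b₂ 0 1] := by
  ext i
  fin_cases i <;> simp [killAllVorticityA, killAllGradA]
  all_goals ring

/-- **Pointwise core of the kill-all witness, region A.** The strain is symmetric and trace-free
with `det S = 0` (hence `λ₂(S) = 0`: feasible, non-strictly), and the stretching is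
`ωᵀSω = 4p(a₁b₂ − a₂b₁)` — for the witness `= −4 r V V′ U′`, NOT identically zero although
`det S ≡ 0`. [ours; elementary] -/
theorem killAllWitness_regionA (p a₁ a₂ b₁ b₂ : ℝ) :
    (killAllStrainA a₁ a₂ b₁ b₂).IsSymm ∧ (killAllStrainA a₁ a₂ b₁ b₂).trace = 0 ∧
      (killAllStrainA a₁ a₂ b₁ b₂).det = 0 ∧
      dotProduct (killAllVorticityA p a₁ a₂ b₁ b₂)
          ((killAllStrainA a₁ a₂ b₁ b₂).mulVec (killAllVorticityA p a₁ a₂ b₁ b₂)) =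
        4 * p * (a₁ * b₂ - a₂ * b₁) := by
  refine ⟨?_, ?_, ?_, ?_⟩
  · ext i j
    fin_cases i <;> fin_cases j <;> simp [killAllStrainA]
  · simp [Matrix.trace, Matrix.diag, Fin.sum_univ_three, killAllStrainA]
  · norm_num [killAllStrainA, Matrix.det_fin_three, Matrix.cons_val_zero, Matrix.cons_val_one,
      Matrix.cons_val_two, Matrix.head_cons, Matrix.tail_cons]
  · simp [killAllStrainA, killAllVorticityA, Matrix.mulVec, dotProduct, Fin.sum_univ_three]
    ring

/-- Hence `λ₂ = 0` at every point of region A. [ours; elementary] -/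
theorem middle_killAllStrainA_eq_zero (p a₁ a₂ b₁ b₂ : ℝ) :
    (Matrix.isHermitian_iff_isSymm.mpr (killAllWitness_regionA p a₁ a₂ b₁ b₂).1).eigenvalues₀
      (Fin.cast (Fintype.card_fin 3).symm 1) = 0 :=
  middle_eq_zero_of_det_eq_zero (Fintype.card_fin 3) _ (killAllWitness_regionA p a₁ a₂ b₁ b₂).1
    (killAllWitness_regionA p a₁ a₂ b₁ b₂).2.1 (killAllWitness_regionA p a₁ a₂ b₁ b₂).2.2.1

/-- Velocity gradient of the witness in REGION B (`U ≡ 0`, cutoff `χ(r)` active):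
`v = χ(r)V(z)(−y, x, 0)` has `∇v = !![−q x y, −q y² − c, −a y; q x² + c, q x y, a x; 0, 0, 0]` with
`q = χ′V/r`, `c = χV`, `a = χV′`. [ours] -/
def killAllGradB (x y q c a : ℝ) : Matrix (Fin 3) (Fin 3) ℝ :=
  !![-(q * x * y), -(q * y ^ 2) - c, -(a * y); q * x ^ 2 + c, q * x * y, a * x; 0, 0, 0]

/-- Its strain. [ours] -/
def killAllStrainB (x y q a : ℝ) : Matrix (Fin 3) (Fin 3) ℝ :=
  !![-(q * x * y), q * (x ^ 2 - y ^ 2) / 2, -(a * y) / 2;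
     q * (x ^ 2 - y ^ 2) / 2, q * x * y, a * x / 2;
     -(a * y) / 2, a * x / 2, 0]

/-- Its vorticity `(−a x, −a y, q (x² + y²) + 2c)`. [ours] -/
def killAllVorticityB (x y q c a : ℝ) : Fin 3 → ℝ := ![-(a * x), -(a * y), q * (x ^ 2 + y ^ 2) + 2 * c]

/-- The strain of region B is the symmetric part of the gradient. [ours; bookkeeping] -/
theorem killAllStrainB_apply (x y q c a : ℝ) (i j : Fin 3) :
    killAllStrainB x y q a i j = (killAllGradB x y q c a i j + killAllGradB x y q c a j i) / 2 := by
  fin_cases i <;> fin_cases j <;> simp [killAllStrainB, killAllGradB] <;> ring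

/-- The vorticity of region B is the axial vector of the gradient. [ours; bookkeeping] -/
theorem killAllVorticityB_eq (x y q c a : ℝ) :
    killAllVorticityB x y q c a =
      ![killAllGradB x y q c a 2 1 - killAllGradB x y q c a 1 2,
        killAllGradB x y q c a 0 2 - killAllGradB x y q c a 2 0,
        killAllGradB x y q c a 1 0 - killAllGradB x y q c a 0 1] := by
  ext i
  fin_cases i <;> simp [killAllVorticityB, killAllGradB]
  all_goals ring

/-- **Pointwise core of the kill-all witness, region B**: an axisymmetric pure swirl is a
structural zero — symmetric, trace-free, `det S = 0` (so `λ₂ = 0`) and `ωᵀSω = 0`.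
[ours; elementary] -/
theorem killAllWitness_regionB (x y q c a : ℝ) :
    (killAllStrainB x y q a).IsSymm ∧ (killAllStrainB x y q a).trace = 0 ∧
      (killAllStrainB x y q a).det = 0 ∧
      dotProduct (killAllVorticityB x y q c a)
          ((killAllStrainB x y q a).mulVec (killAllVorticityB x y q c a)) = 0 := by
  refine ⟨?_, ?_, ?_, ?_⟩
  · ext i j
    fin_cases i <;> fin_cases j <;> simp [killAllStrainB]
  · simp [Matrix.trace, Matrix.diag, Fin.sum_univ_three, killAllStrainB]
  · norm_num [killAllStrainB, Matrix.det_fin_three, Matrix.cons_val_zero, Matrix.cons_val_one,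
      Matrix.cons_val_two, Matrix.head_cons, Matrix.tail_cons]
    ring
  · simp [killAllStrainB, killAllVorticityB, Matrix.mulVec, dotProduct, Fin.sum_univ_three]
    ring

/-- Hence `λ₂ = 0` at every point of region B. [ours; elementary] -/
theorem middle_killAllStrainB_eq_zero (x y q c a : ℝ) :
    (Matrix.isHermitian_iff_isSymm.mpr (killAllWitness_regionB x y q c a).1).eigenvalues₀
      (Fin.cast (Fintype.card_fin 3).symm 1) = 0 :=
  middle_eq_zero_of_det_eq_zero (Fintype.card_fin 3) _ (killAllWitness_regionB x y q c a).1
    (killAllWitness_regionB x y q c a).2.1 (killAllWitness_regionB x y q c a).2.2.1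

end MiddleEigen

end Summit.NavierStokesRegularity.FunctionalMining

end
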